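import Literature.Analysis.FluidPDE.SuitableWeakExhaustion
import HarnessLib

/-!
# Suitable weak solutions: invariance under a.e. modification

Analysis/FluidPDE support file over the accepted structures `IsDistributionalNSSolutionOn`
(`WeakSolution.lean`; Caffarelli–Kohn–Nirenberg 1982, (2.1)–(2.2)), `HasWeakSpatialGradientOn` and
`IsSuitableWeakSolutionOn` (`SuitableWeak.lean`; CKN 1982, (2.1)–(2.5); Lin 1998, Def. 1). No new
definitions.

All clauses of these notions see the velocity `u` and the pressure `p` only through integrals
over the region `Q` (or a.e.-in-time statements about spatial integrals over compact subsets of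
`Q`), so they are invariant under modification of `u` and `p` on a Lebesgue-null subset of `Q`:
`IsDistributionalNSSolutionOn.congr_ae`, `HasWeakSpatialGradientOn.congr_ae`,
`IsSuitableWeakSolutionOn.congr_ae`. This is the (tacit) freedom of choosing representatives of
`L^p` classes in CKN 1982, §2; it is used by the forward DSS theory (`ForwardDSSCylinderLimit*`)
to replace the limit of a compactness argument by its scaling-invariant representative.

## References

* L. Caffarelli, R. Kohn, L. Nirenberg, *Partial regularity of suitable weak solutions of the
  Navier–Stokes equations*, Comm. Pure Appl. Math. 35 (1982), §2, (2.1)–(2.5).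
-/

noncomputable section

open MeasureTheory TopologicalSpace Set Function Filter
open scoped InnerProductSpace RealInnerProductSpace ENNReal NNReal Laplacian Topology

namespace Literature.Analysis.FluidPDE

variable {E : Type*} [NormedAddCommGroup E] [InnerProductSpace ℝ E] [FiniteDimensional ℝ E]
  [MeasurableSpace E] [BorelSpace E]

section CongrAE

variable {Q : Opens (ℝ × E)} {ν : ℝ} {f u u' : ℝ → E → E} {p p' : ℝ → E → ℝ}
  {G : ℝ → E → E →L[ℝ] E}

/-- **Distributional solutions are invariant under a.e. modification** of `u` and `p` on `Q`
(CKN 1982, (2.1)–(2.2) are statements about `L^p` classes). [cite: CaffarelliKohnNirenberg1982, §2 (2.1)–(2.2)] -/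
theorem IsDistributionalNSSolutionOn.congr_ae (h : IsDistributionalNSSolutionOn Q ν f u p)
    (hu : ∀ᵐ z ∂(volume.restrict (Q : Set (ℝ × E))), uncurry u z = uncurry u' z)
    (hp : ∀ᵐ z ∂(volume.restrict (Q : Set (ℝ × E))), uncurry p z = uncurry p' z) :
    IsDistributionalNSSolutionOn Q ν f u' p' := by
  obtain ⟨h1, h2, h3, h4, h5⟩ := h
  refine ⟨h1.congr hu, h2.congr ?_, h3.congr hp, fun θ hθ => ?_, fun ψ hψ => ?_⟩
  · filter_upwards [hu] with z hz
    simp only [hz]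
  · rw [← h4 θ hθ]
    refine integral_congr_ae ?_
    filter_upwards [hu] with z hz
    have e : u' z.1 z.2 = u z.1 z.2 := by
      have := hz; simp only [uncurry] at this; exact this.symm
    rw [e]
  · rw [← h5 ψ hψ]
    refine integral_congr_ae ?_
    filter_upwards [hu, hp] with z hz hz'
    have e : u' z.1 z.2 = u z.1 z.2 := by
      have := hz; simp only [uncurry] at this; exact this.symm
    have e' : p' z.1 z.2 = p z.1 z.2 := by
      have := hz'; simp only [uncurry] at this; exact this.symm
    simp only [convect_apply, e, e']

/-- **Weak spatial gradients are invariant under a.e. modification of the field** on `Q` (same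
gradient). [folklore] -/
theorem HasWeakSpatialGradientOn.congr_ae (h : HasWeakSpatialGradientOn Q u G)
    (hu : ∀ᵐ z ∂(volume.restrict (Q : Set (ℝ × E))), uncurry u z = uncurry u' z) :
    HasWeakSpatialGradientOn Q u' G := by
  refine ⟨h.locallyIntegrableOn.congr hu, h.locallyIntegrableOn_grad, fun φ hφ v w => ?_⟩
  rw [← h.integral_fderiv_mul_inner_eq φ hφ v w]
  refine integral_integral_congr_ae_prod ?_
  filter_upwards [ae_imp_of_ae_restrict hu] with z hz
  by_cases hzQ : z ∈ (Q : Set (ℝ × E))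
  · have e : u' z.1 z.2 = u z.1 z.2 := by
      have := hz hzQ; simp only [uncurry] at this; exact this.symm
    rw [e]
  · have h0 : fderiv ℝ (φ z.1) z.2 = 0 := hφ.fderiv_slice_eq_zero (t := z.1) (x := z.2) hzQ
    simp [h0]

/-- **Suitable weak solutions are invariant under a.e. modification** of `u` and `p` on `Q`: the
distributional equations, the classes `u ∈ L^∞_t L²_x`, `p ∈ L^{3/2}`, `∇u ∈ L²` (same weak
gradient) and the local energy inequality only see `u`, `p` through integrals over `Q` (CKN 1982,
§2). [cite: CaffarelliKohnNirenberg1982, §2 (2.1)–(2.5)] -/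
theorem IsSuitableWeakSolutionOn.congr_ae (h : IsSuitableWeakSolutionOn Q ν f u p)
    (hu : ∀ᵐ z ∂(volume.restrict (Q : Set (ℝ × E))), uncurry u z = uncurry u' z)
    (hp : ∀ᵐ z ∂(volume.restrict (Q : Set (ℝ × E))), uncurry p z = uncurry p' z) :
    IsSuitableWeakSolutionOn Q ν f u' p' := by
  have hu' := ae_imp_of_ae_restrict hu
  have hp' := ae_imp_of_ae_restrict hp
  obtain ⟨G, hG, hG2, hloc⟩ := h.localEnergy
  refine
    { distributional := h.distributional.congr_ae hu hp
      energyClass := fun K hK hKc => ?_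
      pressure := fun K hK hKc => ?_
      localEnergy := ⟨G, hG.congr_ae hu, hG2, fun φ hφ hφ0 => ?_⟩ }
  · -- `u ∈ L^∞_t L²_x` on `K`
    obtain ⟨C, hC⟩ := h.energyClass K hK hKc
    refine ⟨C, ?_⟩
    have hprod : ∀ᵐ z : ℝ × E ∂(volume : Measure ℝ).prod (volume : Measure E),
        K.indicator (fun z : ℝ × E => ‖u' z.1 z.2‖ₑ ^ 2) z =
          K.indicator (fun z : ℝ × E => ‖u z.1 z.2‖ₑ ^ 2) z := by
      rw [← Measure.volume_eq_prod]
      filter_upwards [hu'] with z hz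
      by_cases hzK : z ∈ K
      · have e : u' z.1 z.2 = u z.1 z.2 := by
          have := hz (hK hzK); simp only [uncurry] at this; exact this.symm
        simp only [indicator_of_mem hzK, e]
      · simp only [indicator_of_notMem hzK]
    have h2 := Measure.ae_ae_of_ae_prod hprod
    filter_upwards [hC, h2] with t ht ht'
    calc ∫⁻ x, K.indicator (fun z : ℝ × E => ‖u' z.1 z.2‖ₑ ^ 2) (t, x)
        = ∫⁻ x, K.indicator (fun z : ℝ × E => ‖u z.1 z.2‖ₑ ^ 2) (t, x) := lintegral_congr_ae ht'
      _ ≤ C := ht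
  · -- `p ∈ L^{3/2}(K)`
    have hpK : ∀ᵐ z ∂(volume.restrict K), uncurry p z = uncurry p' z :=
      ae_restrict_of_ae_restrict_of_subset hK hp
    calc ∫⁻ z in K, ‖p' z.1 z.2‖ₑ ^ (3 / 2 : ℝ) = ∫⁻ z in K, ‖p z.1 z.2‖ₑ ^ (3 / 2 : ℝ) := by
          refine lintegral_congr_ae ?_
          filter_upwards [hpK] with z hz
          have e : p' z.1 z.2 = p z.1 z.2 := by
            have := hz; simp only [uncurry] at this; exact this.symm
          rw [e]
      _ < ⊤ := h.pressure K hK hKc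
  · -- the local energy inequality
    have e1 : ∫ t, ∫ x, (‖u' t x‖ ^ 2 * (timeDeriv φ t x + ν * Δ (φ t) x) +
          (‖u' t x‖ ^ 2 + 2 * p' t x) * ⟪u' t x, gradient (φ t) x⟫ +
          2 * ⟪f t x, u' t x⟫ * φ t x) =
        ∫ t, ∫ x, (‖u t x‖ ^ 2 * (timeDeriv φ t x + ν * Δ (φ t) x) +
          (‖u t x‖ ^ 2 + 2 * p t x) * ⟪u t x, gradient (φ t) x⟫ +
          2 * ⟪f t x, u t x⟫ * φ t x) := by
      refine integral_integral_congr_ae_prod ?_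
      filter_upwards [hu', hp'] with z hz hz'
      by_cases hzQ : z ∈ (Q : Set (ℝ × E))
      · have e : u' z.1 z.2 = u z.1 z.2 := by
          have := hz hzQ; simp only [uncurry] at this; exact this.symm
        have e' : p' z.1 z.2 = p z.1 z.2 := by
          have := hz' hzQ; simp only [uncurry] at this; exact this.symm
        rw [e, e']
      · have h1 : deriv (fun s => φ s z.2) z.1 = 0 := hφ.deriv_eq_zero (t := z.1) (x := z.2) hzQ
        have h2 : Δ (φ z.1) z.2 = 0 := hφ.laplacian_slice_eq_zero (t := z.1) (x := z.2) hzQ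
        have h3 : gradient (φ z.1) z.2 = 0 := by
          rw [gradient, hφ.fderiv_slice_eq_zero (t := z.1) (x := z.2) hzQ, map_zero]
        have h4 : φ z.1 z.2 = 0 := hφ.apply_eq_zero (t := z.1) (x := z.2) hzQ
        simp [timeDeriv_apply, h1, h2, h3, h4]
    rw [e1]
    exact hloc φ hφ hφ0

end CongrAE

end Literature.Analysis.FluidPDE

end
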